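import Mathlib
import Summits.ResolutionOfSingularities.ResolutionOfSingularities.Theorems.SyzygyFlatteningDefs
import Literature.AlgebraicGeometry.Resolution.NormalSurfaceSingularLocus
import HarnessLib

/-!
# `stub_R1_of_normal` — Serre's (R₁) for normal Noetherian domains of dimension ≤ 2

Stub `stub_R1_of_normal` of the crux `RankOneTermination` (crux
stmt-ResolutionOfSingularities-17044, line `birth`). Pure commutative algebra: in a normal
(integrally closed) Noetherian domain `R` of Krull dimension `≤ 2`, the localisation `R_𝔭` at
every NON-maximal prime `𝔭` is a regular local ring.

Proof. `𝔭 ⊊ 𝔪` for some maximal ideal `𝔪` (`Ideal.exists_le_maximal`; strictness because `𝔭`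
is not maximal), so `height 𝔭 + 1 ≤ height 𝔪 ≤ dim R ≤ 2`
(`Ideal.height_add_one_le_of_lt_of_isPrime`, `Ideal.height_le_ringKrullDim_of_isPrime`), i.e.
`height 𝔭 ≤ 1`, and `dim R_𝔭 = height 𝔭 ≤ 1` (`IsLocalization.AtPrime.ringKrullDim_eq_height`).
`R_𝔭` is a local Noetherian domain, integrally closed (`isIntegrallyClosed_of_isLocalization`,
the prime complement consists of non-zero-divisors), hence a normal Noetherian local domain of
dimension `≤ 1`, hence regular (a field or a DVR; tree lemma
`Literature.AlgebraicGeometry.Resolution.isRegularLocalRing_of_isIntegrallyClosed_of_ringKrullDim_le_one`,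
Matsumura Thm. 11.2; this is the implication "normal ⇒ (R₁)", Matsumura Thm. 11.5 / 23.8).

## Sources

* H. Matsumura, *Commutative Ring Theory*, CUP 1986, Thm. 11.2, Thm. 11.5, Thm. 23.8.
  [Matsumura1987]
-/

noncomputable section

-- single-problem summit: the doubled namespace component `ResolutionOfSingularities` is forced
set_option linter.dupNamespace false

namespace Summit.ResolutionOfSingularities.ResolutionOfSingularities.Theorems.SyzygyFlattening

/-! ## Height bookkeeping -/

/-- In `ℕ∞`, `a + 1 ≤ 2` forces `a ≤ 1`. [folklore] -/
theorem R1_enat_le_one_of_add_one_le_two {a : ℕ∞} (h : a + 1 ≤ 2) : a ≤ 1 := by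
  induction a using ENat.recTopCoe with
  | top =>
    rw [top_add, top_le_iff] at h
    exact absurd h (by decide)
  | coe n =>
    have h' : n + 1 ≤ 2 := by exact_mod_cast h
    exact_mod_cast (show n ≤ 1 by omega)

/-- In a ring of Krull dimension `≤ 2`, a prime ideal which is NOT maximal has height `≤ 1`:
it lies strictly below a maximal ideal, whose height is at most the dimension. [folklore] -/
theorem R1_height_le_one_of_not_isMaximal {R : Type*} [CommRing R] (hdim : ringKrullDim R ≤ 2)
    (𝔭 : Ideal R) [𝔭.IsPrime] (h𝔭 : ¬ 𝔭.IsMaximal) : 𝔭.height ≤ 1 := by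
  obtain ⟨𝔪, h𝔪, hle⟩ := Ideal.exists_le_maximal 𝔭 Ideal.IsPrime.ne_top'
  have hlt : 𝔭 < 𝔪 := lt_of_le_of_ne hle fun h => h𝔭 (h ▸ h𝔪)
  have h1 : 𝔭.height + 1 ≤ 𝔪.height := Ideal.height_add_one_le_of_lt_of_isPrime hlt
  have h2 : (𝔪.height : WithBot ℕ∞) ≤ 2 := Ideal.height_le_ringKrullDim_of_isPrime.trans hdim
  have h2' : 𝔪.height ≤ 2 := WithBot.coe_le_coe.mp h2
  exact R1_enat_le_one_of_add_one_le_two (h1.trans h2')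

/-! ## The stub -/

/-- **STUB `stub_R1_of_normal`** (pure commutative algebra, Serre's `R₁` in dimension `≤ 2`).
In a normal Noetherian domain `R` of Krull dimension `≤ 2`, the localisation at every
NON-maximal prime `𝔭` is a regular local ring: `𝔭 ⊊ 𝔪` for some maximal `𝔪` of height `≤ 2`
gives `height 𝔭 ≤ 1`, so `R_𝔭` is a normal Noetherian local domain of dimension `≤ 1`
(`isIntegrallyClosed_of_isLocalization`, `IsLocalization.AtPrime.ringKrullDim_eq_height`),
hence a field or a DVR, hence regular (tree
`isRegularLocalRing_of_isIntegrallyClosed_of_ringKrullDim_le_one`).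
[cite: Matsumura1987, Thm. 11.2 and Thm. 11.5 (normal ⇒ R₁)] -/
theorem stub_R1_of_normal : ∀ (R : Type) [CommRing R] [IsDomain R] [IsNoetherianRing R]
    [IsIntegrallyClosed R], ringKrullDim R ≤ 2 →
      ∀ 𝔭 : PrimeSpectrum R, ¬ 𝔭.asIdeal.IsMaximal →
        IsRegularLocalRing (Localization.AtPrime 𝔭.asIdeal) := by
  intro R _ _ _ _ hdim 𝔭 h𝔭
  have hht : 𝔭.asIdeal.height ≤ 1 := R1_height_le_one_of_not_isMaximal hdim 𝔭.asIdeal h𝔭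
  haveI : IsIntegrallyClosed (Localization.AtPrime 𝔭.asIdeal) :=
    isIntegrallyClosed_of_isLocalization (Localization.AtPrime 𝔭.asIdeal) 𝔭.asIdeal.primeCompl
      𝔭.asIdeal.primeCompl_le_nonZeroDivisors
  refine Literature.AlgebraicGeometry.Resolution.isRegularLocalRing_of_isIntegrallyClosed_of_ringKrullDim_le_one
    (Localization.AtPrime 𝔭.asIdeal) ?_
  rw [IsLocalization.AtPrime.ringKrullDim_eq_height 𝔭.asIdeal (Localization.AtPrime 𝔭.asIdeal)]
  exact_mod_cast hht

end Summit.ResolutionOfSingularities.ResolutionOfSingularities.Theorems.SyzygyFlattening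

end
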